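import Literature.LinearAlgebra.Matrix.ClassicalLieAlgebrasDimension
import Mathlib.LinearAlgebra.Matrix.BilinearForm
import HarnessLib

/-!
# The symplectic Lie algebra `𝔰𝔭(V, B)` of a nondegenerate antisymmetric bilinear form has dimension `d(d+1)/2`

Topic `Literature/Algebra/Lie`.  Theorems only (no definition, no named fact), Mathlib vocabulary: the skew-adjoint
endomorphisms of a bilinear form `B` are Mathlib's `B.skewAdjointSubmodule` (`LinearMap.skewAdjointSubmodule`,
`X` with `B (X v) w = B v (-X w)`); the count of symmetric matrices `selfAdjointMatricesSubmodule 1` is the tree's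
`Literature.LinearAlgebra.Matrix.finrank_selfAdjointMatricesSubmodule_one` (`= (n+1 choose 2)`), imported.  The tree also has the
MATRIX form `finrank_skewAdjointMatricesSubmodule_of_transpose_eq_neg` (`Geometry/Kaehler/ComplexTorusHodgeLieAlgebraSymplecticDimension`,
for an antisymmetric invertible Gram matrix); this file is the basis-free form for Mathlib's `LinearMap.BilinForm`, which is what the
Hodge-theory files (`Motives/HodgeStructure.Polarization.form`) carry.
Written for the cell `pub-hodgecm2` (COR-CM), seat `b27` (count-neutral Mumford–Tate-rank lane): the Hodge Lie algebra of a
polarized weight-one Hodge structure lies in `𝔰𝔭(H¹, ψ)`, and the type-III count of the lane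
(`Literature/Algebra/Lie/QuaternionCentralizerSkewDimension`, `CorCM/MumfordTateRankSevenTypeThreeConverse`) needs the exact
dimension of `𝔰𝔭`.

PRINTED RESULT.  J. E. Humphreys, GTM 9, §1.2, type `C_l`: for `dim V = 2l` and a nondegenerate skew-symmetric `f`,
`𝔰𝔭(V) = {x | f(x(v), w) = -f(v, x(w))}`; in matrices `x = (m n; p q)` with `nᵀ = n`, `pᵀ = p`, `mᵀ = -q`, so
«`dim 𝔰𝔭(2l, F) = 2l² + l`» `= d(d+1)/2`.  We prove it basis-free: `X ↦ B(X ·, ·)` is a linear isomorphism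
`End V ≅ Bilin(V)` (non-degeneracy) carrying the skew-adjoint `X` exactly onto the SYMMETRIC forms (`B` antisymmetric), and
symmetric forms are symmetric matrices in a basis.

RESULTS (namespace `Literature.Algebra.Lie.SymplecticDimension`; `K` a field):
* `mem_skewAdjointSubmodule_iff_flip_comp_eq` — for `B.flip = -B`: `X` is `B`-skew-adjoint iff the form `B(X ·, ·)` is
  symmetric;
* **`finrank_skewAdjointSubmodule_of_flip_eq_neg`**, `two_mul_finrank_skewAdjointSubmodule_of_flip_eq_neg` — for `B`
  nondegenerate with `B.flip = -B` on `V` of dimension `d`: `dim 𝔰𝔭(V, B) = d(d+1)/2`, `2 · dim = d(d+1)`.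

## References
* [Humphreys1972] J. E. Humphreys, *Introduction to Lie Algebras and Representation Theory*, GTM 9 (1972), §1.2 (the
  classical algebras; `dim C_l = 2l² + l`).
-/

namespace Literature.Algebra.Lie

namespace SymplecticDimension

open Module
open scoped Matrix

/-! ### Skew-adjoint endomorphisms of an antisymmetric form are the symmetric forms -/

section Skew

variable {K : Type*} [Field K] {V : Type*} [AddCommGroup V] [Module K V]

/-- For an antisymmetric form `B` (`B(w, v) = -B(v, w)`): an endomorphism `X` is `B`-skew-adjoint
(`B(Xv, w) = -B(v, Xw)`) iff the bilinear form `B(X ·, ·)` is SYMMETRIC — Humphreys' description of `𝔰𝔭` by symmetric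
blocks. [cite: Humphreys1972, §1.2] -/
theorem mem_skewAdjointSubmodule_iff_flip_comp_eq (B : LinearMap.BilinForm K V) (hflip : B.flip = -B)
    (X : Module.End K V) :
    X ∈ B.skewAdjointSubmodule ↔ (B ∘ₗ X).flip = B ∘ₗ X := by
  have hanti : ∀ u v : V, B v u = -(B u v) := fun u v => by
    have h := LinearMap.congr_fun₂ hflip u v
    simpa only [LinearMap.BilinForm.flip_apply, LinearMap.neg_apply] using h
  rw [LinearMap.mem_skewAdjointSubmodule]
  constructor
  · intro h
    refine LinearMap.ext fun v => LinearMap.ext fun w => ?_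
    rw [LinearMap.flip_apply, LinearMap.comp_apply, LinearMap.comp_apply, h w v, Pi.neg_apply, map_neg,
      hanti, neg_neg]
  · intro h v w
    have hvw := LinearMap.congr_fun₂ h w v
    rw [LinearMap.flip_apply, LinearMap.comp_apply, LinearMap.comp_apply] at hvw
    rw [Pi.neg_apply, map_neg, hvw, hanti]

variable [FiniteDimensional K V]

/-- **`dim 𝔰𝔭(V, B) = d(d+1)/2`** for a nondegenerate antisymmetric bilinear form `B` on `V` of dimension `d`: the map
`X ↦ B(X ·, ·)` is a linear isomorphism `End V ≅ Bilin V` (injective by non-degeneracy, equal dimensions `d²`) carrying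
`𝔰𝔭(V, B)` onto the symmetric forms, which in a basis are the symmetric matrices.  («`dim C_l = 2l² + l`», `d = 2l`.)
[cite: Humphreys1972, §1.2] -/
theorem finrank_skewAdjointSubmodule_of_flip_eq_neg (B : LinearMap.BilinForm K V) (hB : B.Nondegenerate)
    (hflip : B.flip = -B) :
    finrank K B.skewAdjointSubmodule = finrank K V * (finrank K V + 1) / 2 := by
  classical
  set d := finrank K V with hd
  let b := Module.finBasis K V
  -- `Φ X = B ∘ X`, a linear injection `End V → Bilin V` between spaces of dimension `d²`
  let Φ : Module.End K V →ₗ[K] LinearMap.BilinForm K V := LinearMap.llcomp K V V (V →ₗ[K] K) B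
  have hΦ : ∀ X, Φ X = B ∘ₗ X := fun X => rfl
  have hinj : Function.Injective Φ := by
    refine (injective_iff_map_eq_zero Φ).2 fun X hX => ?_
    rw [hΦ] at hX
    refine LinearMap.ext fun v => hB.1 _ fun w => ?_
    have h := LinearMap.congr_fun₂ hX v w
    rwa [LinearMap.comp_apply, LinearMap.zero_apply, LinearMap.zero_apply] at h
  have hdim : finrank K (Module.End K V) = finrank K (LinearMap.BilinForm K V) := by
    rw [Module.finrank_linearMap, Module.finrank_linearMap, Module.finrank_linearMap, Module.finrank_self, mul_one]
  have hsurj : Function.Surjective Φ := by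
    have hr : LinearMap.range Φ = ⊤ :=
      Submodule.eq_top_of_finrank_eq (K := K) (V := LinearMap.BilinForm K V) (by
        rw [← hdim]
        exact LinearMap.finrank_range_of_inj (M := Module.End K V) (N := LinearMap.BilinForm K V) hinj)
    exact LinearMap.range_eq_top.1 hr
  let Φe : Module.End K V ≃ₗ[K] LinearMap.BilinForm K V := LinearEquiv.ofBijective Φ ⟨hinj, hsurj⟩
  have hΦe : ∀ X, Φe X = B ∘ₗ X := fun X => rfl
  -- `Ψ = toMatrix b ∘ Φe : End V ≃ Matrix`, and `X ∈ 𝔰𝔭 ↔ Ψ X` symmetric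
  let Ψ : Module.End K V ≃ₗ[K] Matrix (Fin d) (Fin d) K := Φe.trans (LinearMap.BilinForm.toMatrix b)
  have hΨ : ∀ X (i j : Fin d), Ψ X i j = B (X (b i)) (b j) := fun X i j => by
    change LinearMap.BilinForm.toMatrix b (Φe X) i j = _
    rw [LinearMap.BilinForm.toMatrix_apply, hΦe, LinearMap.comp_apply]
  have hflipmat : ∀ F : LinearMap.BilinForm K V,
      LinearMap.BilinForm.toMatrix b (LinearMap.flip F) = (LinearMap.BilinForm.toMatrix b F)ᵀ := fun F => by
    ext i j
    rw [LinearMap.BilinForm.toMatrix_apply, Matrix.transpose_apply, LinearMap.BilinForm.toMatrix_apply,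
      LinearMap.flip_apply]
  have key : ∀ X : Module.End K V,
      X ∈ B.skewAdjointSubmodule ↔ Ψ X ∈ selfAdjointMatricesSubmodule (1 : Matrix (Fin d) (Fin d) K) := by
    intro X
    rw [mem_skewAdjointSubmodule_iff_flip_comp_eq B hflip, Literature.LinearAlgebra.Matrix.mem_selfAdjointMatricesSubmodule_one_iff,
      ← (LinearMap.BilinForm.toMatrix b).injective.eq_iff, hflipmat]
    change (LinearMap.BilinForm.toMatrix b (Φe X))ᵀ = LinearMap.BilinForm.toMatrix b (Φe X) ↔ (Ψ X)ᵀ = Ψ X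
    rfl
  have hmap : B.skewAdjointSubmodule.map (Ψ : Module.End K V →ₗ[K] Matrix (Fin d) (Fin d) K) =
      selfAdjointMatricesSubmodule (1 : Matrix (Fin d) (Fin d) K) := by
    ext A
    rw [Submodule.mem_map_equiv, key, LinearEquiv.apply_symm_apply]
  rw [← LinearEquiv.finrank_map_eq Ψ B.skewAdjointSubmodule, hmap,
    Literature.LinearAlgebra.Matrix.finrank_selfAdjointMatricesSubmodule_one, Fintype.card_fin, Nat.choose_two_right,
    Nat.add_sub_cancel, mul_comm]

/-- `2 · dim 𝔰𝔭(V, B) = d(d+1)` (the division-free form of `finrank_skewAdjointSubmodule_of_flip_eq_neg`).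
[cite: Humphreys1972, §1.2] -/
theorem two_mul_finrank_skewAdjointSubmodule_of_flip_eq_neg (B : LinearMap.BilinForm K V) (hB : B.Nondegenerate)
    (hflip : B.flip = -B) :
    2 * finrank K B.skewAdjointSubmodule = finrank K V * (finrank K V + 1) := by
  rw [finrank_skewAdjointSubmodule_of_flip_eq_neg B hB hflip]
  have h2 : 2 ∣ finrank K V * (finrank K V + 1) := (Nat.even_mul_succ_self _).two_dvd
  exact Nat.mul_div_cancel' h2

end Skew

end SymplecticDimension

end Literature.Algebra.Lie
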